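import Literature.NumberTheory.GaloisRepresentations.ContinuousCorestrictionDoubleCoset
import HarnessLib

/-!
# Finiteness of `D \ G / N` and of the `D`-orbits `D ⧸ (D ∩ gNg⁻¹)` for `N` of finite index

Topic `NumberTheory/GaloisRepresentations`; namespace `Literature.NumberTheory.GaloisRepresentations`.
Theorems only (no definition, no named fact).  Complement to `ContinuousCorestrictionDoubleCoset.lean`
(the double-coset formula `res_D ∘ cor_{G/N} = Σ_{DgN} cor ∘ conjRes`, whose `DoubleCoset.Quotient` form
takes `Fintype` instances on `D \ G / N` and on the orbits as arguments): when `G ⧸ N` is finite, so are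
the double-coset space `D \ G / N` (a quotient of `G ⧸ N`) and every orbit
`D ⧸ (D ∩ g N g⁻¹) ≅ D g N / N ⊆ G ⧸ N` (NSW (1.5.6): `G = ⨆_{q} ⨆_{δ ∈ D/(D ∩ g_q N g_q⁻¹)} δ g_q N`).

## References
* J. Neukirch, A. Schmidt, K. Wingberg, *Cohomology of Number Fields*, 2nd ed. (2008), I §5 (1.5.6).
  [NeukirchSchmidtWingberg2008]
-/

namespace Literature.NumberTheory.GaloisRepresentations

variable {G : Type*} [Group G] (N D : Subgroup G)

/-- **`D \ G / N` is finite when `G ⧸ N` is**: `g N ↦ D g N` is a surjection `G ⧸ N → D \ G / N`.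
[cite: NeukirchSchmidtWingberg2008, I §5 (1.5.6)–(1.5.7)] -/
theorem finite_doubleCosetQuotient [Finite (G ⧸ N)] : Finite (DoubleCoset.Quotient (D : Set G) N) := by
  refine Finite.of_surjective (fun x : G ⧸ N => DoubleCoset.mk D N x.out) fun q => ?_
  refine ⟨(q.out : G), ?_⟩
  change DoubleCoset.mk D N ((q.out : G) : G ⧸ N).out = q
  have h : ((q.out : G) : G ⧸ N).out⁻¹ * q.out ∈ N := by
    rw [← QuotientGroup.eq, QuotientGroup.out_eq']
  refine Eq.trans ?_ (DoubleCoset.out_eq' D N q)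
  rw [DoubleCoset.eq]
  exact ⟨1, D.one_mem, ((q.out : G) : G ⧸ N).out⁻¹ * q.out, h, by group⟩

/-- **The orbit `D ⧸ (D ∩ g N g⁻¹)` is finite when `G ⧸ N` is**: `δ ↦ δ g N` is an injection
`D ⧸ (D ∩ g N g⁻¹) → G ⧸ N` (the stabiliser of `g N` in `D` is `D ∩ g N g⁻¹`).
[cite: NeukirchSchmidtWingberg2008, I §5 (1.5.6)–(1.5.7)] -/
theorem finite_quotient_interConj_subgroupOf [Finite (G ⧸ N)] (g : G) :
    Finite (D ⧸ (interConj N D g).subgroupOf D) := by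
  refine Finite.of_injective (Quotient.lift (fun d : D => (((d : G) * g : G) : G ⧸ N)) ?_) ?_
  · intro a b hab
    replace hab := QuotientGroup.leftRel_apply.mp hab
    rw [Subgroup.mem_subgroupOf, mem_interConj] at hab
    change (((a : G) * g : G) : G ⧸ N) = (((b : G) * g : G) : G ⧸ N)
    rw [QuotientGroup.eq]
    have e : ((a : G) * g)⁻¹ * ((b : G) * g) = g⁻¹ * ((a : G)⁻¹ * (b : G)) * g := by group
    rw [e]
    have h := hab.2
    rwa [Subgroup.coe_mul, Subgroup.coe_inv] at h
  · intro x y hxy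
    induction x using QuotientGroup.induction_on with
    | H a =>
      induction y using QuotientGroup.induction_on with
      | H b =>
        change (((a : G) * g : G) : G ⧸ N) = (((b : G) * g : G) : G ⧸ N) at hxy
        rw [QuotientGroup.eq] at hxy
        apply QuotientGroup.eq.mpr
        rw [Subgroup.mem_subgroupOf, mem_interConj, Subgroup.coe_mul, Subgroup.coe_inv]
        refine ⟨D.mul_mem (D.inv_mem a.2) b.2, ?_⟩
        have e : g⁻¹ * ((a : G)⁻¹ * (b : G)) * g = ((a : G) * g)⁻¹ * ((b : G) * g) := by group
        rwa [e]

end Literature.NumberTheory.GaloisRepresentations
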